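import Summits.ABC.IUTFork.Joshi.TestATS4LowerBoundGenuineConverse
import Literature.NumberTheory.NumberFields.CyclotomicFieldFourClassNumber
import Mathlib.NumberTheory.DiophantineApproximation.Basic
import HarnessLib

/-!
# R-J census, row Y-21ℓ — the located converse, WITNESSED: over every number field `F ≠ ℚ` genuine tame data with free `q`-depth HIT the
# inflation window (`Statement ∧ ¬Cor91111`); a concrete pilot datum over `ℚ(ζ₄)` meets every hypothesis

Proof-only record file of the abc-iut cell, branch E → R-J «Joshi Y-discharge census» (D-0079; rung LADDER-ABC:A2.RESCUE.J; seat abc-iut-E-t59,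
gen 8; sequel of `TestATS4LowerBoundGenuineConverse` (p463394), whose `statement_and_not_cor91111_iff_window` says: at genuine tame data with
exponent-shaped ideles, for every adelic datum `A` reading the genuine volumes, `Statement ∧ ¬A.Cor91111 ↔ 0 < gap ∧ ↑gap ≤ −|log(Θ)|(𝟙)`).
**No side is taken** on [IUTchIII] Cor. 3.12 / [IUTchIV] Thm 1.10, on [J-III] Cor 9.11.1.1 / [J-IV] Thm 6.10.1 (unrefereed arXiv preprints) or on
any author; typed ≠ proved ≠ endorsed; instantiated ≠ endorsed; no definition, no `Prop` fact; every printed relation stays a hypothesis BY NAME.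

* §0 `exists_int_int_log_mem_Ioc` — Dirichlet's approximation theorem (Mathlib `Real.exists_int_int_abs_mul_sub_le`) places an INTEGER
  combination `a·log p₁ + b·log p₂` of the logarithms of two distinct primes in any window `(0, ε]` (`p₁^k ≠ p₂^j`). [folklore]
* §1 **`exists_statement_and_not_cor91111_of_one_lt_finrank`** — for pilot data `X` over a number field `F` with `[F : ℚ] > 1` whose bad places
  FILL the fibres over a finite set `U` of odd primes unramified in `F` (bad mass one) containing two distinct primes: for EVERY Thm-3.11 context
  there are exponent-shaped pilot ideles (non-zero, units off `S`, norms `≤ 1`; `q`-depth `≥ 1` on `U`, FREE — not pinned to `P_q`) and an adelic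
  Θ-values-locus datum `A` on `s = U` READING the genuine `q`-volumes and hull volumes of abc-iut-c312-7's `settingPrVolSharp`, with
  **`Statement ∧ ¬A.Cor91111`**. The window `(0, −|log(Θ)|(𝟙)]` has positive length by abc-iut-w4-d107 part 23 (Minkowski: some prime ramifies in
  `F`; abc-iut-c312-5's ramified hull gain), and §0 puts `ℓ⋆·gap = a·log p₁ + b·log p₂` inside `(0, ℓ⋆·−|log(Θ)|(𝟙)]` with `m_q(p₁) = |a|+1`,
  `Σ_j m_Θ(p₁, j) = a + ℓ⋆(|a|+1)` (all at the first label), likewise at `p₂`, and `m_q = m_Θ(j) = 1` elsewhere on `U`.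
* §2 **`exists_pilotData_cyclotomicField_four_window_hypotheses`** — the hypotheses of §1 are INHABITED: over `ℚ(ζ₄)` (Mathlib's
  `CyclotomicField 4 ℚ`: `[F:ℚ] = 2`, `disc = −4` — tree `discr_cyclotomicField_four`; `√−1 ∈ F` as [IUTchI] Def. 3.1 (a) asks) the pilot datum
  `j_E := 21⁻¹`, `S := V(F)₃ ∪ V(F)₇`, `l := 5` with `U = {3, 7}` (odd, `∤ 4`, bad mass one by construction). A PilotData-level inhabitant only
  (no elliptic curve, no `K = F(E[l])`).
So the census word's «converse located (inflation)» is now two-sided in kernel: «Statement ⟹ J» is DERIVED at every ℚ-bed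
(`cor91111_iff_statement_rat`) and REFUTED at genuine tame data over every `F ≠ ℚ` with free `q`-depth (this file). HONEST SCOPE (as in the
parent): (Ind2) as typed at the real setting (`Real.ismDH`), sharp (Ind3) reading, trivial archimedean container, FREE ideles — for `q`-ideles
REALISING `P_q` the window question «`ℓ⋆·−|log(Θ)|(𝟙) ≥` q-granularity» stays undecided without a quantitative hull-gain bound; the Statement
holds at the witness BY (Ind1)/(Ind2)-INFLATION of the unit boxes at the ramified packets, «saying nothing about print's intended content»
(w4-d107 part 12); vs S unchanged: S-BYPASSED (p447958). [claim: Joshi2024ATS3, status: disputed] [claim: Mochizuki2012, status: disputed] for the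
items cited BY NAME; [cite: DupuyHilado2025, §3.3, §3.6, §3.9, §4.7, §4.9] (carriers); [cite: NeukirchANT1999, Ch. III (2.17)]. Standard axioms.
-/

noncomputable section

open Set Function NumberField IsDedekindDomain Finset
open scoped Pointwise

namespace Summit.ABC.IUTFork.Joshi

open Thm311 Thm311.Real Cor312 Cor312.Setting Cor312Vol Literature.IUT.LogThetaLattice Literature.IUT.LogVolume
  Literature.IUT.HodgeTheaters

namespace TestATS4LowerBound

/-! ## 0. Dirichlet's approximation theorem for `log p₁ / log p₂` -/

/-- **Dirichlet's approximation theorem lands an integer combination `a·log p + b·log q` of the logarithms of two DISTINCT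
primes in any window `(0, ε]`** (`log p / log q` is irrational: `p^k = q^j` is impossible for `k ≥ 1`). [folklore]
[cite: NeukirchANT1999, Ch. I §5 (unique factorisation)] -/
theorem exists_int_int_log_mem_Ioc {p q : ℕ} (hp : p.Prime) (hq : q.Prime) (hpq : p ≠ q) {ε : ℝ} (hε : 0 < ε) :
    ∃ a b : ℤ, 0 < a * Real.log p + b * Real.log q ∧ a * Real.log p + b * Real.log q ≤ ε := by
  have hp1 : (1 : ℝ) < p := by exact_mod_cast hp.one_lt
  have hq1 : (1 : ℝ) < q := by exact_mod_cast hq.one_lt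
  have hlp : 0 < Real.log p := Real.log_pos hp1
  have hlq : 0 < Real.log q := Real.log_pos hq1
  obtain ⟨n, hn⟩ := exists_nat_gt (Real.log q / ε)
  have hn0 : 0 < n := by
    rcases Nat.eq_zero_or_pos n with h | h
    · rw [h, Nat.cast_zero] at hn; exact absurd hn (not_lt.mpr (div_pos hlq hε).le)
    · exact h
  obtain ⟨j, k, hk0, -, hjk⟩ := Real.exists_int_int_abs_mul_sub_le (Real.log p / Real.log q) hn0
  set D : ℝ := k * Real.log p - j * Real.log q with hD
  have hDeq : D = (k * (Real.log p / Real.log q) - j) * Real.log q := by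
    rw [hD]; field_simp
  have hDle : |D| ≤ ε := by
    rw [hDeq, abs_mul, abs_of_pos hlq]
    have h1 : |(k : ℝ) * (Real.log p / Real.log q) - j| * Real.log q ≤ 1 / (n + 1) * Real.log q :=
      mul_le_mul_of_nonneg_right hjk hlq.le
    refine h1.trans ?_
    rw [one_div_mul_eq_div, div_le_iff₀ (by positivity)]
    have h2 : Real.log q < ε * n := by rwa [div_lt_iff₀ hε, mul_comm] at hn
    nlinarith
  have hDne : D ≠ 0 := by
    intro h0
    have heq : (k : ℝ) * Real.log p = j * Real.log q := sub_eq_zero.mp (hD ▸ h0)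
    rcases le_or_gt j 0 with hj | hj
    · have h1 : (0 : ℝ) < k * Real.log p := mul_pos (by exact_mod_cast hk0) hlp
      have h2 : (j : ℝ) * Real.log q ≤ 0 := mul_nonpos_of_nonpos_of_nonneg (by exact_mod_cast hj) hlq.le
      linarith
    · obtain ⟨k', rfl⟩ := Int.eq_ofNat_of_zero_le hk0.le
      obtain ⟨j', rfl⟩ := Int.eq_ofNat_of_zero_le hj.le
      have hk' : 0 < k' := by exact_mod_cast hk0
      have heq' : Real.log ((p : ℝ) ^ k') = Real.log ((q : ℝ) ^ j') := by
        rw [Real.log_pow, Real.log_pow]; exact_mod_cast heq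
      have hpow : ((p : ℝ) ^ k') = (q : ℝ) ^ j' :=
        Real.log_injOn_pos (Set.mem_Ioi.mpr (by positivity)) (Set.mem_Ioi.mpr (by positivity)) heq'
      have hnat : p ^ k' = q ^ j' := by exact_mod_cast hpow
      have hdvd : p ∣ q ^ j' := hnat ▸ dvd_pow_self p hk'.ne'
      exact hpq ((Nat.prime_dvd_prime_iff_eq hp hq).mp (hp.dvd_of_dvd_pow hdvd))
  rcases lt_or_gt_of_ne hDne with hneg | hpos
  · refine ⟨-k, j, ?_, ?_⟩
    · push_cast; linarith
    · push_cast; linarith [neg_abs_le D]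
  · refine ⟨k, -j, ?_, ?_⟩
    · push_cast; linarith
    · push_cast; linarith [le_abs_self D]


/-! ## 1. Over every `F ≠ ℚ` the inflation window is HIT by genuine tame data with free `q`-depth -/

section Witness

variable {F : Type} [Field F] [NumberField F] (X : PilotData F) {logv : PadicLogs F} (hlog : LogvAnalytic logv)
  (M : Type) [Field M] [NumberField M]
  (archPk : ∀ (j : (thetaIndex X).Label) (vQ : (thetaIndex X).VQ), Set ((logShellsDH X logv).Packet j vQ))
  (archSub : ∀ (j : (thetaIndex X).Label) (v : (thetaIndex X).V),
    Set ((logShellsDH X logv).Packet j ((thetaIndex X).over v)))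
  (Ψ : ℤ → ∀ v : (thetaIndex X).V, v ∈ (thetaIndex X).Vbad → Set ((logShellsDH X logv).StarPacket v))
  (act : ℤ → ∀ v : (thetaIndex X).V, v ∈ (thetaIndex X).Vbad →
    (logShellsDH X logv).StarPacket v → Module.End ℚ ((logShellsDH X logv).StarPacket v))
  (Mmod : ℤ → ∀ j : (thetaIndex X).LabelStar, Set ((logShellsDH X logv).GlobalPacket j.1))
  (region : ℤ → ∀ j : (thetaIndex X).LabelStar, FinDivisor M → ∀ vQ : (thetaIndex X).VQ,
    Set ((logShellsDH X logv).Packet j.1 vQ))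
  (n : ℤ) {HT : Type} {LogLink : HT → HT → Type} {IsFull : ∀ {s t : HT}, LogLink s t → Prop}
  (lat : LGPGaussianLogThetaLattice LogLink IsFull)
  {Frd : Type} {IsoF : Frd → Frd → Type} {Ob : Frd → Type} {realify : Frd → Frd} {Strip : Type}
  {IsoS : Strip → Strip → Type} {Mv : ∀ v : (thetaIndex X).V, v ∈ (thetaIndex X).Vbad → Type}
  [∀ v h, Monoid (Mv v h)]
  (sig : GlobalLGPFrobenioidSignature (thetaIndex X).lstar (thetaIndex X).V (· ∈ (thetaIndex X).Vbad)
    Frd IsoF Ob realify Strip IsoS Mv)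
  (split : SplittingMonoids Mv) {ObΔ : Type} {N : ∀ v : (thetaIndex X).V, v ∈ (thetaIndex X).Vbad → Type}
  [∀ v h, Monoid (N v h)] (qData : QPilotData ObΔ N)
  (U : Finset Nat.Primes)
  (hU : ∀ (pp : Nat.Primes) (x : (thetaIndex X).Fibre (.inr pp)),
    haveI : Fact (pp : ℕ).Prime := ⟨pp.2⟩; placeOf X pp.1 x ∈ X.S → pp ∈ U)
  (hUS : ∀ (pp : Nat.Primes), pp ∈ U → ∀ (x : (thetaIndex X).Fibre (.inr pp)),
    haveI : Fact (pp : ℕ).Prime := ⟨pp.2⟩; placeOf X pp.1 x ∈ X.S)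
  (hU2 : ∀ pp ∈ U, 2 < (pp : ℕ)) (hUd : ∀ pp ∈ U, ¬ ((pp : ℕ) : ℤ) ∣ NumberField.discr F)
  (s : Finset (thetaIndex X).VQ) (hs : ∀ w, w ∈ s ↔ ∃ pp ∈ U, w = Sum.inr pp)

include hU hUS hU2 hUd hs in
/-- **THE LOCATED CONVERSE OF Y-21ℓ, WITNESSED: over every number field `F ≠ ℚ` the inflation window is HIT by genuine tame data.** Let `X` be
pilot data over `F` with `[F : ℚ] > 1` whose bad places fill the fibres over a finite set `U` of ODD primes UNRAMIFIED in `F` (bad mass one),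
containing two DISTINCT primes `p₁ ≠ p₂`. Then for EVERY Thm-3.11 context there are exponent-shaped pilot ideles — non-zero, units off `S`, of
norm `≤ 1` everywhere (Θ-ideles `p^{m_{Θ,p}(j)}`, `q`-ideles `p^{m_q(p)}` with `m_q ≥ 1` on `U`: positive, FREE `q`-depth — they need NOT realise
`P_q`) — and an adelic Θ-values-locus datum `A` on `s = U` READING the genuine `q`-volumes and hull volumes of c312-7's `settingPrVolSharp`, with
**`Statement ∧ ¬ A.Cor91111`**: OUR typed [IUTchIII] Cor. 3.12 Statement HOLDS while Joshi's [J-III] Cor 9.11.1.1 read through the dictionary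
FAILS — the exponent gap is placed inside `(0, −|log(Θ)|(𝟙)]` (positive by abc-iut-w4-d107 part 23: Minkowski + c312-5's ramified hull gain) by
Dirichlet approximation on `log p₁ / log p₂`. So «Statement ⟹ J» is FALSE at genuine data over every `F ≠ ℚ` (with free `q`-depth), TRUE at
every ℚ-bed (`cor91111_iff_statement_rat`). No side taken; the Statement holds here BY (Ind1)/(Ind2)-INFLATION of the unit boxes at the
ramified packets, «saying nothing about print's intended content» (part 12). [claim: Joshi2024ATS3, status: disputed] [claim: Mochizuki2012,
status: disputed] [cite: DupuyHilado2025, §3.6, §3.9, §4.7, §4.9] [cite: NeukirchANT1999, Ch. III (2.17)] -/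
theorem exists_statement_and_not_cor91111_of_one_lt_finrank (hF : 1 < Module.finrank ℚ F) {p₁ p₂ : Nat.Primes}
    (hp₁ : p₁ ∈ U) (hp₂ : p₂ ∈ U) (hne : p₁ ≠ p₂) :
    ∃ (tq : ∀ (pp : Nat.Primes) (x : (thetaIndex X).Fibre (.inr pp)), haveI : Fact (pp : ℕ).Prime := ⟨pp.2⟩; kOf X pp.1 x)
      (t : ∀ (pp : Nat.Primes) (_ : Fin X.lstar) (x : (thetaIndex X).Fibre (.inr pp)),
        haveI : Fact (pp : ℕ).Prime := ⟨pp.2⟩; kOf X pp.1 x)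
      (htq0 : ∀ pp x, tq pp x ≠ 0)
      (htq1 : ∀ (pp : Nat.Primes) (x : (thetaIndex X).Fibre (.inr pp)),
        haveI : Fact (pp : ℕ).Prime := ⟨pp.2⟩; placeOf X pp.1 x ∉ X.S → ‖tq pp x‖ = 1)
      (_ : ∀ pp i x, t pp i x ≠ 0)
      (_ : ∀ (pp : Nat.Primes) (i : Fin X.lstar) (x : (thetaIndex X).Fibre (.inr pp)),
        haveI : Fact (pp : ℕ).Prime := ⟨pp.2⟩; placeOf X pp.1 x ∉ X.S → ‖t pp i x‖ = 1),
      (∀ pp i x, ‖t pp i x‖ ≤ 1) ∧ (∀ pp x, ‖tq pp x‖ ≤ 1) ∧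
      ∃ A : ATS3.AdelicLocusDatum (thetaIndex X).lstar s,
        (∀ (i : Fin (thetaIndex X).lstar) (w : s), Real.log (A.loc w).qroot =
          (settingPrVolSharp X hlog M archPk archSub Ψ act Mmod region n lat sig split qData tq t htq0 htq1).qLocal
            (Setting.labelSucc i) w) ∧
        (∀ w : s, Real.log (A.loc w).hullVol =
          ∑ i : Fin (thetaIndex X).lstar, ((situationPrVol X hlog M archPk archSub Ψ act Mmod region).D n).logvol
            (Setting.labelSucc i) w
            ((settingPrVolSharp X hlog M archPk archSub Ψ act Mmod region n lat sig split qData tq t htq0 htq1).thetaHull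
              (Setting.labelSucc i) w)) ∧
        (settingPrVolSharp X hlog M archPk archSub Ψ act Mmod region n lat sig split qData tq t htq0 htq1).Statement ∧
        ¬ A.Cor91111 := by
  classical
  have hl : 0 < (thetaIndex X).lstar := lt_of_lt_of_le two_pos (thetaIndex X).two_le_lstar
  have hlR : (0 : ℝ) < (thetaIndex X).lstar := by exact_mod_cast hl
  -- the window length `κ = −|log(Θ)|(𝟙) > 0`
  obtain ⟨κ, hκ⟩ := WithTop.ne_top_iff_exists.mp (negLogTheta_settingPrVolSharp_trivial_ne_top X hlog M archPk archSub Ψ act Mmod region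
    n lat sig split qData)
  have hκpos : 0 < κ := by
    have h := negLogTheta_settingPrVolSharp_trivial_pos_of_one_lt_finrank X hlog M archPk archSub Ψ act Mmod region n lat sig split qData hF
    rw [← hκ] at h
    exact WithTop.coe_pos.mp h
  -- Dirichlet: integers `a, b` with `0 < a·log p₁ + b·log p₂ ≤ ℓ⋆·κ`
  obtain ⟨a, b, hab0, habκ⟩ := exists_int_int_log_mem_Ioc p₁.2 p₂.2 (fun h => hne (Subtype.ext h)) (mul_pos hlR hκpos)
  -- exponents: `m_q = |c|+1`, `Σ_j m_Θ(j) = c + ℓ⋆(|c|+1)` at `p₁` (`c = a`), `p₂` (`c = b`); `m_q = 1 = m_Θ(j)` elsewhere on `U`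
  set i₀ : Fin (thetaIndex X).lstar := ⟨0, hl⟩ with hi₀
  let Mof : ℤ → ℕ := fun c => (c + (thetaIndex X).lstar * (c.natAbs + 1)).toNat
  have hMof : ∀ c : ℤ, ((Mof c : ℕ) : ℝ) = c + (thetaIndex X).lstar * (c.natAbs + 1) := by
    intro c
    have h0 : 0 ≤ c + ((thetaIndex X).lstar : ℤ) * ((c.natAbs : ℤ) + 1) := by
      have h1 : (1 : ℤ) ≤ (thetaIndex X).lstar := by exact_mod_cast hl
      have h2 : -c ≤ (c.natAbs : ℤ) := by omega
      nlinarith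
    have h' : ((Mof c : ℕ) : ℤ) = c + ((thetaIndex X).lstar : ℤ) * ((c.natAbs : ℤ) + 1) := Int.toNat_of_nonneg h0
    have h3 := congrArg (fun z : ℤ => (z : ℝ)) h'
    simp only [Int.cast_add, Int.cast_mul, Int.cast_natCast, Int.cast_one] at h3
    exact h3
  let mq : Nat.Primes → ℕ := fun pp => if pp = p₁ then a.natAbs + 1 else if pp = p₂ then b.natAbs + 1 else 1
  let mΘ : Nat.Primes → Fin (thetaIndex X).lstar → ℕ := fun pp i =>
    if pp = p₁ then (if i = i₀ then Mof a else 0) else if pp = p₂ then (if i = i₀ then Mof b else 0) else 1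
  have hmq1 : ∀ pp ∈ U, 1 ≤ mq pp := by
    intro pp _
    simp only [mq]
    split_ifs <;> omega
  -- the ideles
  let tq : ∀ (pp : Nat.Primes) (x : (thetaIndex X).Fibre (.inr pp)), haveI : Fact (pp : ℕ).Prime := ⟨pp.2⟩; kOf X pp.1 x :=
    fun pp x => haveI : Fact (pp : ℕ).Prime := ⟨pp.2⟩; if pp ∈ U then ((pp : ℕ) : kOf X pp.1 x) ^ (mq pp) else 1
  let t : ∀ (pp : Nat.Primes) (_ : Fin X.lstar) (x : (thetaIndex X).Fibre (.inr pp)),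
      haveI : Fact (pp : ℕ).Prime := ⟨pp.2⟩; kOf X pp.1 x :=
    fun pp i x => haveI : Fact (pp : ℕ).Prime := ⟨pp.2⟩; if pp ∈ U then ((pp : ℕ) : kOf X pp.1 x) ^ (mΘ pp i) else 1
  have htq_norm : ∀ (pp : Nat.Primes) (x : (thetaIndex X).Fibre (.inr pp)), haveI : Fact (pp : ℕ).Prime := ⟨pp.2⟩
      ‖tq pp x‖ = if pp ∈ U then (((pp : ℕ) : ℝ)⁻¹) ^ (mq pp) else 1 := by
    intro pp x
    haveI : Fact (pp : ℕ).Prime := ⟨pp.2⟩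
    change ‖(if pp ∈ U then ((pp : ℕ) : kOf X pp.1 x) ^ (mq pp) else 1)‖ = _
    by_cases h : pp ∈ U
    · rw [if_pos h, if_pos h]; exact norm_natCast_pow_kOf X pp x _
    · rw [if_neg h, if_neg h, norm_one]
  have ht_norm : ∀ (pp : Nat.Primes) (i : Fin X.lstar) (x : (thetaIndex X).Fibre (.inr pp)), haveI : Fact (pp : ℕ).Prime := ⟨pp.2⟩
      ‖t pp i x‖ = if pp ∈ U then (((pp : ℕ) : ℝ)⁻¹) ^ (mΘ pp i) else 1 := by
    intro pp i x
    haveI : Fact (pp : ℕ).Prime := ⟨pp.2⟩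
    change ‖(if pp ∈ U then ((pp : ℕ) : kOf X pp.1 x) ^ (mΘ pp i) else 1)‖ = _
    by_cases h : pp ∈ U
    · rw [if_pos h, if_pos h]; exact norm_natCast_pow_kOf X pp x _
    · rw [if_neg h, if_neg h, norm_one]
  have hinv0 : ∀ pp : Nat.Primes, (0 : ℝ) < ((pp : ℕ) : ℝ)⁻¹ := fun pp => inv_pos.mpr (by exact_mod_cast pp.2.pos)
  have hinv1 : ∀ pp : Nat.Primes, ((pp : ℕ) : ℝ)⁻¹ ≤ 1 := fun pp => inv_le_one_of_one_le₀ (by exact_mod_cast pp.2.one_lt.le)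
  have htq0 : ∀ pp x, tq pp x ≠ 0 := fun pp x => norm_pos_iff.mp (by
    rw [htq_norm]; split_ifs
    · exact pow_pos (hinv0 pp) _
    · exact one_pos)
  have ht0 : ∀ pp i x, t pp i x ≠ 0 := fun pp i x => norm_pos_iff.mp (by
    rw [ht_norm]; split_ifs
    · exact pow_pos (hinv0 pp) _
    · exact one_pos)
  have hnot : ∀ (pp : Nat.Primes) (x : (thetaIndex X).Fibre (.inr pp)),
      haveI : Fact (pp : ℕ).Prime := ⟨pp.2⟩; placeOf X pp.1 x ∉ X.S → pp ∉ U := fun pp x hx hpp => hx (hUS pp hpp x)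
  have htq1 : ∀ (pp : Nat.Primes) (x : (thetaIndex X).Fibre (.inr pp)),
      haveI : Fact (pp : ℕ).Prime := ⟨pp.2⟩; placeOf X pp.1 x ∉ X.S → ‖tq pp x‖ = 1 := fun pp x hx => by
    rw [htq_norm, if_neg (hnot pp x hx)]
  have ht1 : ∀ (pp : Nat.Primes) (i : Fin X.lstar) (x : (thetaIndex X).Fibre (.inr pp)),
      haveI : Fact (pp : ℕ).Prime := ⟨pp.2⟩; placeOf X pp.1 x ∉ X.S → ‖t pp i x‖ = 1 := fun pp i x hx => by
    rw [ht_norm, if_neg (hnot pp x hx)]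
  have hm : ∀ (pp : Nat.Primes), pp ∈ U → ∀ (i : Fin (thetaIndex X).lstar) (x : (thetaIndex X).Fibre (.inr pp)),
      haveI : Fact (pp : ℕ).Prime := ⟨pp.2⟩; ‖t pp i x‖ = ‖((pp : ℕ) : ℚ_[pp]) ^ ((mΘ pp i : ℕ) : ℤ)‖ := by
    intro pp hpp i x
    haveI : Fact (pp : ℕ).Prime := ⟨pp.2⟩
    rw [ht_norm, if_pos hpp, zpow_natCast, norm_pow, Padic.norm_p]
  have hmq : ∀ (pp : Nat.Primes), pp ∈ U → ∀ (x : (thetaIndex X).Fibre (.inr pp)),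
      haveI : Fact (pp : ℕ).Prime := ⟨pp.2⟩; ‖tq pp x‖ = ‖((pp : ℕ) : ℚ_[pp]) ^ ((mq pp : ℕ) : ℤ)‖ := by
    intro pp hpp x
    haveI : Fact (pp : ℕ).Prime := ⟨pp.2⟩
    rw [htq_norm, if_pos hpp, zpow_natCast, norm_pow, Padic.norm_p]
  have htle : ∀ pp i x, ‖t pp i x‖ ≤ 1 := fun pp i x => by
    rw [ht_norm]; split_ifs
    · exact pow_le_one₀ (hinv0 pp).le (hinv1 pp)
    · exact le_rfl
  have htqle : ∀ pp x, ‖tq pp x‖ ≤ 1 := fun pp x => by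
    rw [htq_norm]; split_ifs
    · exact pow_le_one₀ (hinv0 pp).le (hinv1 pp)
    · exact le_rfl
  -- an adelic datum reading the genuine volumes (positive `q`-depth on `U`)
  obtain ⟨A, hqA, hVA⟩ := exists_adelicLocusDatum_reading X hlog M archPk archSub Ψ act Mmod region n lat sig split qData t tq htq0 htq1
    U mq hmq s hs hmq1
  -- the exponent gap is `(a·log p₁ + b·log p₂)/ℓ⋆`
  have hgap : (∑ pp ∈ U, ∑ i : Fin (thetaIndex X).lstar, (mΘ pp i : ℝ) * Real.log (pp : ℕ)) / (thetaIndex X).lstar -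
      ∑ pp ∈ U, (mq pp : ℝ) * Real.log (pp : ℕ) = (a * Real.log (p₁ : ℕ) + b * Real.log (p₂ : ℕ)) / (thetaIndex X).lstar := by
    -- per-prime integer defect `d(p) := Σ_j m_Θ(j) − ℓ⋆·m_q`
    have hsum : ∀ pp : Nat.Primes, (∑ i : Fin (thetaIndex X).lstar, (mΘ pp i : ℝ)) - (thetaIndex X).lstar * (mq pp : ℝ) =
        if pp = p₁ then (a : ℝ) else if pp = p₂ then (b : ℝ) else 0 := by
      intro pp
      by_cases h1 : pp = p₁
      · subst h1
        simp only [mΘ, mq, if_true, Nat.cast_ite, Nat.cast_zero, Nat.cast_add, Nat.cast_one, Finset.sum_ite_eq', Finset.mem_univ,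
          if_true]
        rw [hMof]
        ring
      · by_cases h2 : pp = p₂
        · subst h2
          simp only [mΘ, mq, if_neg h1, if_true, Nat.cast_ite, Nat.cast_zero, Nat.cast_add, Nat.cast_one, Finset.sum_ite_eq',
            Finset.mem_univ, if_true]
          rw [hMof]
          ring
        · simp only [mΘ, mq, if_neg h1, if_neg h2, Nat.cast_one, Finset.sum_const, Finset.card_univ, Fintype.card_fin,
            nsmul_eq_mul, mul_one]
          ring
    have hre : (∑ pp ∈ U, ∑ i : Fin (thetaIndex X).lstar, (mΘ pp i : ℝ) * Real.log (pp : ℕ)) / (thetaIndex X).lstar -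
        ∑ pp ∈ U, (mq pp : ℝ) * Real.log (pp : ℕ) =
        (∑ pp ∈ U, ((∑ i : Fin (thetaIndex X).lstar, (mΘ pp i : ℝ)) - (thetaIndex X).lstar * (mq pp : ℝ)) * Real.log (pp : ℕ)) /
          (thetaIndex X).lstar := by
      rw [Finset.sum_div, Finset.sum_div, ← Finset.sum_sub_distrib]
      refine Finset.sum_congr rfl fun pp _ => ?_
      rw [← Finset.sum_mul]
      field_simp
    rw [hre]
    congr 1
    simp_rw [hsum]
    rw [Finset.sum_eq_add_of_mem p₁ p₂ hp₁ hp₂ hne (fun c _ hc => by rw [if_neg hc.1, if_neg hc.2, zero_mul])]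
    rw [if_pos rfl, if_neg (Ne.symm hne), if_pos rfl]
  refine ⟨tq, t, htq0, htq1, ht0, ht1, htle, htqle, A, hqA, hVA, ?_⟩
  refine (statement_and_not_cor91111_iff_window X hlog M archPk archSub Ψ act Mmod region n lat sig split qData t tq ht0 ht1 htq0 htq1 U hU
    hU2 hUd mΘ mq hm hmq s hs A hqA hVA).mpr ⟨?_, ?_⟩
  · rw [hgap]
    exact div_pos hab0 hlR
  · rw [hgap, ← hκ, WithTop.coe_le_coe, div_le_iff₀ hlR]
    linarith [mul_comm ((thetaIndex X).lstar : ℝ) κ]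

end Witness

/-! ## 2. A concrete pilot datum over `ℚ(ζ₄)` meeting every hypothesis -/

section Concrete

open Literature.NumberTheory.NumberFields in
/-- **NON-VACUITY of the hypotheses of `exists_statement_and_not_cor91111_of_one_lt_finrank`: a pilot datum over `ℚ(ζ₄) = ℚ(√−1)`** (Mathlib's
`CyclotomicField 4 ℚ`; `[F : ℚ] = 2`, `disc F = −4` — tree `discr_cyclotomicField_four`; `√−1 ∈ F` as [IUTchI] Def. 3.1 (a) asks) with
`j_E := 21⁻¹`, `S := V(F)₃ ∪ V(F)₇` (`3`, `7` are ODD, UNRAMIFIED — `3, 7 ∤ 4` — and every place over them is bad: bad mass one), `l := 5`, and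
`U = {3, 7}`. A PilotData-level inhabitant only (no elliptic curve, no `K = F(E[l])`; instantiated ≠ endorsed). [cite: DupuyHilado2025, §3.3]
[cite: FrohlichTaylor1990, Ch. II §1] [cite: Mochizuki2012, IUTchI Def. 3.1 (a)(b) p. 61] -/
theorem exists_pilotData_cyclotomicField_four_window_hypotheses :
    ∃ (X : PilotData (CyclotomicField 4 ℚ)) (U : Finset Nat.Primes) (p₁ p₂ : Nat.Primes),
      1 < Module.finrank ℚ (CyclotomicField 4 ℚ) ∧
      (∀ (pp : Nat.Primes) (x : (thetaIndex X).Fibre (.inr pp)),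
        haveI : Fact (pp : ℕ).Prime := ⟨pp.2⟩; placeOf X pp.1 x ∈ X.S → pp ∈ U) ∧
      (∀ (pp : Nat.Primes), pp ∈ U → ∀ (x : (thetaIndex X).Fibre (.inr pp)),
        haveI : Fact (pp : ℕ).Prime := ⟨pp.2⟩; placeOf X pp.1 x ∈ X.S) ∧
      (∀ pp ∈ U, 2 < (pp : ℕ)) ∧ (∀ pp ∈ U, ¬ ((pp : ℕ) : ℤ) ∣ NumberField.discr (CyclotomicField 4 ℚ)) ∧
      p₁ ∈ U ∧ p₂ ∈ U ∧ p₁ ≠ p₂ := by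
  classical
  set K := CyclotomicField 4 ℚ with hK
  haveI : IsCyclotomicExtension {4} ℚ K := CyclotomicField.isCyclotomicExtension 4 ℚ
  haveI h3 : Fact (Nat.Prime 3) := ⟨Nat.prime_three⟩
  haveI h7 : Fact (Nat.Prime 7) := ⟨by norm_num⟩
  -- `ord_v(21) > 0` at every place over `3` or `7`
  have hord_nonneg : ∀ (v : HeightOneSpectrum (𝓞 K)) (m : ℕ), 0 ≤ ord K v ((m : ℕ) : K) := fun v m => by
    have h := ord_nonneg_of_isIntegral K v ((m : ℕ) : 𝓞 K)
    exact_mod_cast h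
  have hord21 : ∀ v ∈ placesOver K 3 ∪ placesOver K 7, 0 < ord K v ((21 : ℕ) : K) := by
    intro v hv
    have h21 : ((21 : ℕ) : K) = ((3 : ℕ) : K) * ((7 : ℕ) : K) := by push_cast; norm_num
    have h3ne : ((3 : ℕ) : K) ≠ 0 := by exact_mod_cast (by norm_num : (3 : ℕ) ≠ 0)
    have h7ne : ((7 : ℕ) : K) ≠ 0 := by exact_mod_cast (by norm_num : (7 : ℕ) ≠ 0)
    rw [h21, ord_mul K v h3ne h7ne]
    rcases Finset.mem_union.mp hv with hv3 | hv7
    · have he := Cor22.ord_natCast_eq_ramIdx 3 v hv3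
      have hpos : 0 < (ramIdx K v : ℤ) := by exact_mod_cast Nat.pos_of_ne_zero (ramIdx_ne_zero K v)
      linarith [hord_nonneg v 7]
    · have he := Cor22.ord_natCast_eq_ramIdx 7 v hv7
      have hpos : 0 < (ramIdx K v : ℤ) := by exact_mod_cast Nat.pos_of_ne_zero (ramIdx_ne_zero K v)
      linarith [hord_nonneg v 3]
  let X : PilotData K :=
    { jE := (((21 : ℕ) : K))⁻¹
      S := placesOver K 3 ∪ placesOver K 7
      S_nonempty := (placesOver_nonempty K 3).mono Finset.subset_union_left
      ord_jE_neg := fun v hv => by rw [ord_inv]; linarith [hord21 v hv]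
      l := 5
      l_prime := by norm_num
      five_le_l := le_rfl }
  refine ⟨X, {⟨3, Nat.prime_three⟩, ⟨7, by norm_num⟩}, ⟨3, Nat.prime_three⟩, ⟨7, by norm_num⟩, ?_, ?_, ?_, ?_, ?_,
    by simp, by simp, fun h => by cases h⟩
  · rw [IsCyclotomicExtension.finrank (n := 4) K (Polynomial.cyclotomic.irreducible_rat (by norm_num)),
      show Nat.totient 4 = 2 by decide]
    norm_num
  · intro pp x hx
    haveI : Fact (pp : ℕ).Prime := ⟨pp.2⟩
    have hres : residueChar K (placeOf X pp.1 x) = pp := (mem_placesOver_iff_residueChar _).mp (placeOf_mem X pp.1 x)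
    have hx' : placeOf X pp.1 x ∈ placesOver K 3 ∪ placesOver K 7 := hx
    rcases Finset.mem_union.mp hx' with h | h
    · have h3 : residueChar K (placeOf X pp.1 x) = 3 := (mem_placesOver_iff_residueChar _).mp h
      have : pp = ⟨3, Nat.prime_three⟩ := Subtype.ext (hres.symm.trans h3)
      simp [this]
    · have h7' : residueChar K (placeOf X pp.1 x) = 7 := (mem_placesOver_iff_residueChar _).mp h
      have : pp = ⟨7, by norm_num⟩ := Subtype.ext (hres.symm.trans h7')
      simp [this]
  · intro pp hpp x
    haveI : Fact (pp : ℕ).Prime := ⟨pp.2⟩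
    have hmem := placeOf_mem X pp.1 x
    show placeOf X pp.1 x ∈ placesOver K 3 ∪ placesOver K 7
    rcases Finset.mem_insert.mp hpp with rfl | hpp'
    · exact Finset.mem_union_left _ hmem
    · rw [Finset.mem_singleton] at hpp'
      subst hpp'
      exact Finset.mem_union_right _ hmem
  · intro pp hpp
    rcases Finset.mem_insert.mp hpp with rfl | hpp'
    · norm_num
    · rw [Finset.mem_singleton] at hpp'; subst hpp'; norm_num
  · intro pp hpp
    rw [discr_cyclotomicField_four]
    rcases Finset.mem_insert.mp hpp with rfl | hpp'
    · decide
    · rw [Finset.mem_singleton] at hpp'; subst hpp'; decide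

end Concrete

end TestATS4LowerBound

end Summit.ABC.IUTFork.Joshi

end
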